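import Summits.ABC.StewartYu.PadicTwistCoreBound
import HarnessLib

/-!
# Cell abc-stewartyu, WP-Y provider B (xiv): the core bound of the ± chain — statement (any twist order,
# SIGNED Kummer condition) and the case `d = 0`

`Summits/ABC/StewartYu/PadicTwistPMCoreBound.lean` — cell `abc-stewartyu`, seat p3 (crux `W80OneModFour`
stmt-ABC-19487). Twin of p2's `TwistCoreBound` / `coreBound_of_d_zero` for the `p ≡ 1 (mod 4)` provider: the
twist order `G ≤ p` is arbitrary (the provider uses `G = p − 1`) and the Kummer hypothesis is the SIGNED one
(`∏_{i∈T} allᵢ` and `−∏_{i∈T} allᵢ` non-squares), which is what the half step in `ℂ_p` consumes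
(`classSums_eq_zero_of_norm_Φ_half_lt`) and what excludes `θ = −1` in the case `d = 0` when `G` is even.
[cite: Yu1990, Theorem 2.1] [cite: Waldschmidt1980, Prop. 3.8 (p. 263)].
-/

noncomputable section

open NormedSpace Finset IsUltrametricDist Height
open Literature.NumberTheory.Transcendental
open scoped Nat

namespace Summit.ABC.StewartYu

namespace TwistSetup

/-- **The core bound of the ± twisted machine** (any twist order `G ≤ p`, SIGNED Kummer condition):
`‖Λ₀‖_p > exp(−C(d+1) · G · (∏(Vⱼ/log p) · V_θ/log p) · (W + log 2V_max) · log(2V_max))`.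
[cite: Yu1990, Theorem 2.1] [cite: Waldschmidt1980, Prop. 3.8 (p. 263)] -/
def TwistCoreBoundPM (C : ℕ → ℝ) : Prop :=
  ∀ (p : ℕ) [Fact p.Prime] (S : TwistSetup p) (V : Fin S.d → ℝ) (Vθ Vmax W : ℝ), S.G ≤ p →
    (∀ T : Finset (Fin (S.d + 1)), T.Nonempty →
      ¬ IsSquare (∏ i ∈ T, S.toQ.all i) ∧ ¬ IsSquare (-∏ i ∈ T, S.toQ.all i)) →
    (∀ μ : Fin (S.d + 1) → ℤ, ∏ i, S.toQ.all i ^ μ i = 1 → μ = 0) →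
    (∀ j, logHeight₁ (S.α j) ≤ V j) → logHeight₁ S.θ ≤ Vθ →
    (∀ j, Real.log p ≤ V j) → Real.log p ≤ Vθ → (∀ j, V j ≤ Vmax) → Vθ ≤ Vmax →
    (∀ j, Real.log (max 3 (|S.b j| : ℝ)) ≤ W) → Real.log (max 3 (|S.bθ| : ℝ)) ≤ W → Real.log p ≤ W →
    Real.exp (-(C (S.d + 1) * S.G * ((∏ j, V j / Real.log p) * (Vθ / Real.log p)) *
      (W + Real.log (2 * Vmax)) * Real.log (2 * Vmax))) < ‖S.Λ₀‖

/-- **The core bound for `d = 0`, ANY twist order** (signed Kummer instead of `G` odd) — (one twisted logarithm `ω_θ = θ η_θ`): for `3 ≤ C 1` and `θ` not a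
square (so `θ^G ≠ 1`, `G` odd), the inequality of `TwistCoreBound` holds by Liouville alone:
`‖1 − ω_θ‖ ≥ ‖1 − ω_θ^G‖ = ‖1 − θ^G‖ ≥ 1/(2H(θ)^G)` and `U = C·G·(V_θ/log p)·(W + log 2Vmax)·log 2Vmax
> G·h(θ) + log 2` (`W ≥ log p`). [cite: Yu1990, §1.1 and Lemma 1.3] -/
theorem coreBound_of_d_zero_pm {p : ℕ} [Fact p.Prime] (S : TwistSetup p) (hd : S.d = 0)
    (hK' : ¬ IsSquare (-S.θ))
    {C : ℕ → ℝ} (hC1 : 3 ≤ C 1) (hK : ¬ IsSquare S.θ) (V : Fin S.d → ℝ) (Vθ Vmax W : ℝ)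
    (hVθ : logHeight₁ S.θ ≤ Vθ) (hVθp : Real.log p ≤ Vθ) (hVθm : Vθ ≤ Vmax) (hWp : Real.log p ≤ W) :
    Real.exp (-(C (S.d + 1) * S.G * ((∏ j, V j / Real.log p) * (Vθ / Real.log p)) *
      (W + Real.log (2 * Vmax)) * Real.log (2 * Vmax))) < ‖S.Λ₀‖ := by
  have hV1 : ∏ j : Fin S.d, V j / Real.log p = 1 := by
    have : IsEmpty (Fin S.d) := by rw [hd]; infer_instance
    exact Finset.prod_eq_one fun j _ => (IsEmpty.false j).elim
  rw [hV1, one_mul, S.norm_Λ₀_eq_of_d_zero hd]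
  simp only [hd, zero_add]
  -- numerics
  have hlog3 : 1 < Real.log 3 := by
    rw [Real.lt_log_iff_exp_lt (by norm_num)]
    have := Real.exp_one_lt_d9; linarith
  have hlog2 := Real.log_two_gt_d9
  have hlog2' := Real.log_two_lt_d9
  have hlp : 1 < Real.log p := lt_of_lt_of_le hlog3 (Real.log_le_log (by norm_num) S.three_le_p)
  have hlp0 : 0 < Real.log p := by linarith
  have hVθ1 : 1 < Vθ := lt_of_lt_of_le hlp hVθp
  have hl2V : Real.log 2 ≤ Real.log (2 * Vmax) := Real.log_le_log two_pos (by linarith)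
  have hG1 : (1 : ℝ) ≤ S.G := by exact_mod_cast S.hG
  have hHpos : 0 < CW77.hgt S.θ := lt_of_lt_of_le one_pos (CW77.one_le_hgt _)
  have hH : Real.log (CW77.hgt S.θ) = logHeight₁ S.θ := by rw [Rat.logHeight₁_eq_log_max]; rfl
  have hlogH0 : 0 ≤ logHeight₁ S.θ := by rw [← hH]; exact Real.log_nonneg (CW77.one_le_hgt _)
  -- `θ^G ≠ 1` (else `θ = 1`, a square, or `θ = −1`, and then `−θ = 1` is a square)
  have hθG : S.θ ^ S.G ≠ 1 := by
    intro h1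
    rcases (pow_eq_one_iff_of_ne_zero S.hG.ne').mp h1 with h | ⟨h, _⟩
    · exact hK (by rw [h]; exact ⟨1, by norm_num⟩)
    · exact hK' (by rw [h, neg_neg]; exact ⟨1, by norm_num⟩)
  -- `‖1 − ω‖ ≥ ‖1 − ω^G‖ = ‖1 − θ^G‖`
  have hωθ : S.ω (Fin.last S.d) = (S.θ : ℚ_[p]) * S.η (Fin.last S.d) := by
    unfold TwistSetup.ω SetupQ.all; rw [Fin.snoc_last]
  have hpow : S.ω (Fin.last S.d) ^ S.G = (S.θ : ℚ_[p]) ^ S.G := by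
    rw [hωθ, mul_pow, S.hηG, mul_one]
  have hgeom : ‖1 - S.ω (Fin.last S.d) ^ S.G‖ ≤ ‖1 - S.ω (Fin.last S.d)‖ := by
    rw [← mul_neg_geom_sum, norm_mul]
    refine mul_le_of_le_one_right (norm_nonneg _) ?_
    refine IsUltrametricDist.norm_sum_le_of_forall_le_of_nonneg zero_le_one fun i _ => ?_
    rw [norm_pow, S.norm_ω, one_pow]
  have hLiou := norm_one_sub_pow_ge (p := p) S.θ S.G hθG
  rw [← hpow] at hLiou
  have hU : logHeight₁ S.θ * S.G + Real.log 2 <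
      C 1 * S.G * (Vθ / Real.log p) * (W + Real.log (2 * Vmax)) * Real.log (2 * Vmax) := by
    have hC0 : (0 : ℝ) ≤ C 1 := by linarith
    have e1 : C 1 * S.G * (Vθ / Real.log p) * (W + Real.log (2 * Vmax)) * Real.log (2 * Vmax) =
        C 1 * (S.G * Vθ) * ((W + Real.log (2 * Vmax)) / Real.log p) * Real.log (2 * Vmax) := by
      field_simp
    rw [e1]
    have hq : 1 ≤ (W + Real.log (2 * Vmax)) / Real.log p := by
      rw [le_div_iff₀ hlp0]; linarith
    have hGV : (1 : ℝ) ≤ S.G * Vθ := by nlinarith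
    have h3 : logHeight₁ S.θ * S.G ≤ S.G * Vθ := by nlinarith
    have h4 : C 1 * (S.G * Vθ) * ((W + Real.log (2 * Vmax)) / Real.log p) * Real.log (2 * Vmax) ≥
        3 * (S.G * Vθ) * 1 * 0.69 := by
      have : (0.69 : ℝ) ≤ Real.log (2 * Vmax) := by linarith
      gcongr
    nlinarith
  calc Real.exp (-(C 1 * S.G * (Vθ / Real.log p) * (W + Real.log (2 * Vmax)) * Real.log (2 * Vmax)))
      < Real.exp (-(logHeight₁ S.θ * S.G + Real.log 2)) := by rw [Real.exp_lt_exp]; linarith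
    _ = 1 / (2 * CW77.hgt S.θ ^ S.G) := by
        rw [Real.exp_neg, ← hH, Real.exp_add, mul_comm (Real.log (CW77.hgt S.θ)), ← Real.log_pow,
          Real.exp_log (pow_pos hHpos _), Real.exp_log two_pos, one_div, mul_comm]
    _ ≤ ‖1 - S.ω (Fin.last S.d) ^ S.G‖ := hLiou
    _ ≤ ‖1 - S.ω (Fin.last S.d)‖ := hgeom


end TwistSetup

end Summit.ABC.StewartYu

end
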